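import Summits.QuantumFields.BalabanUV.Gaps.EndContLetterWitness
import Summits.QuantumFields.BalabanUV.Gaps.EndFoliationHeadline

/-!
# Gaps / EndUpperLetterWitness — NEGATIVE N-16 and the BINDER CENSUS of (D)'s END criterion: the upper-bound letter (U) CANNOT be dropped (the
# BLOW-UP family `β_{k+1} := 1∕g_k² − 1 + g_k`), `0 < γ₀` cannot, `0 ≤ β′` is REDUNDANT; a PER-LEVEL bound is load-bearing while uniformity in
# `k` is spare (the (U) census by END socket); and the (C) column (trace continuity along the clamped foliation load-bearing, continuity off it
# spare) — a PORT into the tree, with attribution, of g1-plan-2 GEN 17∕18's lens kernel `HOME/g1/skeletons/XreadHordFadingMemory_plan2.lean`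
# (v1.8, sha16 4a2dd778a9e40b0b, §10 and the witness parts of §11 ∕ §12 ∕ §13; lens items S-43 ∕ R-35 = N-16, S-44 ∕ R-36, S-45 ∕ R-37; offered for
# porting in [G1-PLAN2-G17-S43] ∕ [G1-PLAN2-G18-S45])
# (cell pub-balaban-gaps, seat g1-p3 gen 7, row CAP+tail ∕ β-currency «split ∕ weakening»; file 5 — the collector — of «the binder census of the
# END roads»: imports the witness leaf `EndContLetterWitness` and, through `EndFoliationHeadline`, `EndUpperPerLevel` ∕ `EndContAlongFoliation`)

HONEST FRAMING (cell rule, page 1 of everything): a TOY β-family (real analysis on an explicit construction; unbounded like `1∕g²` at `g ↓ 0` —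
physically absurd and precisely what (U), [I] §1 p. 264 «uniformly bounded», excludes) over the tree's typed carriers (`FlowStep.HBeta` ∕ `Box` ∕
`RGEqH` ∕ `solveCoupling` ∕ `genSeq`, `DagBinding.EndpointExistence` ∕ `modelOf`).  AUTHORSHIP: the mathematics and the Lean text of every
declaration below are g1-plan-2 GEN 17∕18's (planner seat; planners file nothing on the ledger by mandate — «provers may port»); this seat's
contribution is the port (namespace, imports, this header, references to the tree's leaves in place of the kernel's internal §-numbers) and the
kernel re-check against the tree.  The statements are about the HYPOTHESIS SET of (D)'s criterion `EndTopRunCriterion.endpointExistence_modelOf_iff_topRuns`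
and of `Gaps/EndUpperPerLevel`; NOTHING of Bałaban's is asserted; 0∕6 binders; 0 coefficients certified; words ∕ odds UNCHANGED; one finite T⁴;
NOT B12 Thm 2, NOT `BetaPertH`, NOT the continuum limit, NOT Clay.

THE POINT (g1-plan-2 S-43 ∕ R-35 and S-44 ∕ R-36, verbatim in substance).  (D)'s `endpointExistence_modelOf_iff_topRuns` has FIVE binders: the side
conditions `0 < γ₀`, `0 ≤ β′` and the three ANALYTIC letters `hcont : BetaContH γ₀ β` (C), `hhi : BetaUpperH β′ γ₀ β` (U), `hord` (order).
`Gaps/EndContLetterWitness` deleted (C) (floor staircase, N-15); `Gaps/EndTopRunCrossingWitness` (and g1-plan-2's MODEL kernel, spike family)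
deleted the order letter.  This leaf deletes the rest: (U) — the BLOW-UP family `betaU k p := 1∕p_last² − 1 + p_last` (Markov; jointly
continuous on every box; `≥ 0` on `Box 1`) admits NO in-interval run of length `≥ 1` at any level `γ ≤ 1` (`1∕g_1² = 1 − g_0 < 1 ≤ 1∕γ²`), so
`hord` and the top-run condition hold at every level `γ ≤ 1`, yet `¬ EndpointExistence (modelOf betaU)` (at `K = 1` the flow map
`g_0 ↦ (1 − g_0)^{−1∕2}` misses `]0, 1∕2]`): **`endTopRunCriterion_false_without_hhi`** (N-16), `not_betaUpperH_betaU` (DERIVED from the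
criterion); `0 < γ₀` — at `γ₀ = 0` every box is empty (`endTopRunCriterion_false_without_hpos`); `0 ≤ β′` is REDUNDANT (`max β′ 0`:
`endpointExistence_modelOf_iff_topRuns_noSign`).  CENSUS (R-35 ∕ R-36, zero weight): of (D)'s five binders FOUR are load-bearing, each with a
witness, ONE is redundant (**`endTopRunCriterion_binderCensus`**); in the (U) column a PER-LEVEL bound is load-bearing (`not_perLevelUpper_betaU`:
the blow-up family violates it and `EndUpperPerLevel`'s conclusion) while uniformity in `k` is consumed by NO END socket of the tree
(`upperLetter_perLevel_census`, `upperLetter_perLevel_census_roads`); in the (C) column (§4) the floor staircase of `EndContLetterWitness` is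
DIScontinuous even ALONG THE CLAMPED FOLIATION at every level (`not_folCont_betaJ`, DERIVED from `EndContAlongFoliation`'s criterion): trace
continuity is load-bearing, continuity OFF the foliation is spare (`contLetter_foliation_census`).
0 sorry; ONE toy definition (`betaU`, an explicit real function, no `def … : Prop`); imports `Gaps/EndContLetterWitness` + `Gaps/EndFoliationHeadline`
(which re-export `EndUpperPerLevel`, `EndContAlongFoliation`, (D), (A)); restates nothing of the tree.

CITATION HEADER (tags CONTEXT ONLY).  [I] = T. Bałaban, Commun. Math. Phys. **109** (1987) [Balaban1987RG1]: Thm 2 p. 259, (0.20) p. 256,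
§1 p. 264 ((U) printed uniformly).
-/

namespace Summit.QuantumFields.BalabanUV.Gaps.EndUpperLetterWitness

open Literature.MathematicalPhysics.QuantumFieldTheory.Balaban1983to89
open Literature.MathematicalPhysics.QuantumFieldTheory.Balaban1983to89.FlowStep
open Literature.MathematicalPhysics.QuantumFieldTheory.Balaban1983to89.FlowStepRuns
open Literature.MathematicalPhysics.QuantumFieldTheory.Balaban1983to89.DagBinding
open Summit.QuantumFields.BalabanUV.Gaps.EndRunwiseShooting
open Summit.QuantumFields.BalabanUV.Gaps.EndTopRunCriterion
open Summit.QuantumFields.BalabanUV.Gaps.EndUpperPerLevel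
open Summit.QuantumFields.BalabanUV.Gaps.EndContAlongFoliation
open Summit.QuantumFields.BalabanUV.Gaps.EndContLetterWitness
open Summit.QuantumFields.BalabanUV.Gaps.EndFoliationHeadline
open Topology Finset

noncomputable section

/-! ## §1 The blow-up family `betaU`: sign, (C), `hord` and top runs at every level `≤ 1`, NO `EndpointExistence` (g1-plan-2 kernel §10, ported) -/

/-- The BLOW-UP family `β_{k+1}(g_0,…,g_k) := 1∕g_k² − 1 + g_k` (Markov; a TOY β, physically absurd — exactly what (U) excludes). [folklore] -/
def betaU : HBeta := fun k p => 1 / (p (Fin.last k)) ^ 2 - 1 + p (Fin.last k)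

/-- Unfolding. [folklore] -/
theorem betaU_apply (k : ℕ) (p : Fin (k + 1) → ℝ) : betaU k p = 1 / (p (Fin.last k)) ^ 2 - 1 + p (Fin.last k) := rfl

/-- SIGN: `0 ≤ β` on `Box 1` (indeed `β ≥ g_k > 0` there). [folklore] -/
theorem betaLowerH_betaU : BetaLowerH 0 1 betaU := by
  intro k v hv
  have h := (mem_box.mp hv) (Fin.last k)
  rw [betaU_apply]
  have h1 : 1 ≤ 1 / (v (Fin.last k)) ^ 2 := by
    rw [le_div_iff₀ (pow_pos h.1 2), one_mul]
    nlinarith [h.1, h.2]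
  linarith [h.1]

/-- (C): jointly continuous on EVERY box (the last coupling is `> 0` there). [folklore] -/
theorem betaContH_betaU (γ : ℝ) : BetaContH γ betaU := by
  intro k
  apply continuousOn_of_forall_continuousAt
  intro p hp
  have hp0 : 0 < p (Fin.last k) := ((mem_box).mp hp (Fin.last k)).1
  have h1 : ContinuousAt (fun q : Fin (k + 1) → ℝ => q (Fin.last k)) p := continuousAt_apply (Fin.last k) p
  have h2 : ContinuousAt (fun q : Fin (k + 1) → ℝ => (q (Fin.last k)) ^ 2) p := h1.pow 2
  have h3 : ContinuousAt (fun q : Fin (k + 1) → ℝ => (1 : ℝ) / (q (Fin.last k)) ^ 2) p :=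
    continuousAt_const.div h2 (pow_ne_zero 2 hp0.ne')
  show ContinuousAt (fun q : Fin (k + 1) → ℝ => 1 / (q (Fin.last k)) ^ 2 - 1 + q (Fin.last k)) p
  exact (h3.sub continuousAt_const).add h1

/-- The first RG step of ANY run: `1∕g_1² = 1 − g_0`. [folklore] -/
theorem run_one_betaU {n : ℕ} {gs : ℕ → ℝ} (hrg : RGEqH n betaU gs) (hn : 1 ≤ n) : 1 / (gs 1) ^ 2 = 1 - gs 0 := by
  have h := hrg 0 (by omega)
  have hβ : betaU 0 (prefixOf gs 0) = 1 / (gs 0) ^ 2 - 1 + gs 0 := by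
    simp only [betaU_apply, prefixOf_apply, Fin.val_last]
  rw [hβ, zero_add] at h
  linarith

/-- NO in-interval run of length `≥ 1` at any level `γ ≤ 1`: `1∕g_1² = 1 − g_0 < 1 ≤ 1∕γ² ≤ 1∕g_1²`. [folklore] -/
theorem no_run_betaU {γ : ℝ} (hγ : γ ≤ 1) {n : ℕ} {gs : ℕ → ℝ} (hrg : RGEqH n betaU gs) (hI : Step.InInterval γ n gs) :
    n = 0 := by
  by_contra hn
  have hn1 : 1 ≤ n := Nat.one_le_iff_ne_zero.mpr hn
  have h1 := run_one_betaU hrg hn1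
  have hg0 : 0 < gs 0 := (hI 0 (Nat.zero_le _)).1
  have hg1 : 0 < gs 1 ∧ gs 1 ≤ γ := hI 1 hn1
  have h2 : 1 ≤ 1 / (gs 1) ^ 2 := by
    rw [le_div_iff₀ (pow_pos hg1.1 2), one_mul]
    nlinarith [hg1.1, hg1.2, hγ]
  linarith

/-- (D)'s non-crossing hypothesis `hord` at EVERY level `γ ≤ 1` (only length-0 runs exist). [folklore] -/
theorem hord_betaU : ∀ γ : ℝ, 0 < γ → γ ≤ 1 → ∀ (n : ℕ) (gs gs' : ℕ → ℝ),
    RGEqH n betaU gs → RGEqH n betaU gs' → Step.InInterval γ n gs → Step.InInterval γ n gs' → gs 0 < gs' 0 →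
      ∀ k, k ≤ n → gs k < gs' k := by
  intro γ _ hγ n gs gs' hrg _ hI _ h0 k hk
  have hn := no_run_betaU hγ hrg hI
  subst hn
  rw [Nat.le_zero.mp hk]
  exact h0

/-- TOP RUNS at every level `γ ≤ 1` with `g⋆ = γ` (only length-0 runs exist). [folklore] -/
theorem topRuns_betaU {γ : ℝ} (hγ : γ ≤ 1) (n : ℕ) (gs : ℕ → ℝ) (hrg : RGEqH n betaU gs) (hI : Step.InInterval γ n gs) :
    ∀ k, k ≤ n → gs k = γ → γ ≤ gs n := by
  intro k hk hkγ
  have hn := no_run_betaU hγ hrg hI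
  subst hn
  rw [Nat.le_zero.mp hk] at hkγ
  exact hkγ.symm.le

/-- The right-hand side of the top-run CRITERION holds for the blow-up family (`γ₂ := 1`, `g⋆ := γ`). [folklore] -/
theorem topRunCriterion_betaU : ∃ γ₂ : ℝ, 0 < γ₂ ∧ ∀ γ : ℝ, 0 < γ → γ ≤ γ₂ → ∃ gstar : ℝ, 0 < gstar ∧
    ∀ (n : ℕ) (gs : ℕ → ℝ), RGEqH n betaU gs → Step.InInterval γ n gs → ∀ k, k ≤ n → gs k = γ → gstar ≤ gs n :=
  ⟨1, one_pos, fun γ hγ hγ1 => ⟨γ, hγ, fun n gs hrg hI => topRuns_betaU hγ1 n gs hrg hI⟩⟩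

/-- The flow of `modelOf betaU` from ANY bare coupling misses `]0, 1∕2]` at `K = 1`: NOT the END. [folklore] -/
theorem not_endpointExistence_betaU : ¬ EndpointExistence (modelOf betaU) := by
  intro hE
  obtain ⟨γ₂, hγ₂, h⟩ := hE 0
  obtain ⟨gstar, hgstar, h⟩ := h γ₂ hγ₂ le_rfl
  have hgpos : 0 < min gstar (1 / 2) := lt_min hgstar (by norm_num)
  obtain ⟨g0, hI, hK⟩ := h (min gstar (1 / 2)) hgpos (min_le_left _ _) 1
  have hP0 : 0 < genSeq betaU g0 0 ∧ genSeq betaU g0 0 ≤ γ₂ := hI 0 (Nat.zero_le _)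
  rw [genSeq_zero] at hP0
  have hK' : genSeq betaU g0 1 = min gstar (1 / 2) := hK
  have hβ0 : betaU 0 (prefixOf (genSeq betaU g0) 0) = 1 / g0 ^ 2 - 1 + g0 := by
    simp only [betaU_apply, prefixOf_apply, Fin.val_last, genSeq_zero]
  rw [genSeq_succ, genSeq_zero, hβ0] at hK'
  have hs : 1 / g0 ^ 2 - (1 / g0 ^ 2 - 1 + g0) = 1 - g0 := by ring
  rw [hs] at hK'
  rcases le_or_gt (1 - g0) 0 with hle | hgt
  · have h1 := solveCoupling_nonpos hle
    linarith
  · have h1 := inv_sq_solveCoupling hgt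
    rw [hK'] at h1
    have hm : min gstar (1 / 2) ≤ 1 / 2 := min_le_right _ _
    have h4 : 4 ≤ 1 / (min gstar (1 / 2)) ^ 2 := by
      rw [le_div_iff₀ (pow_pos hgpos 2)]
      nlinarith [hm, hgpos]
    linarith [hP0.1]

/-! ## §2 N-16 and the binder census of (D)'s criterion: (U) and `0 < γ₀` load-bearing, `0 ≤ β′` redundant (kernel §10, ported) -/

/-- **N-16: (D)'s END criterion `endpointExistence_modelOf_iff_topRuns` is FALSE with its upper-bound binder `hhi` (and the then-dangling
`0 ≤ β′`) deleted** — even for a Markov, non-negative, jointly continuous family with (D)'s `hord` at every level. [folklore] -/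
theorem endTopRunCriterion_false_without_hhi :
    ¬ ∀ (β : HBeta) (γ₀ : ℝ), 0 < γ₀ → BetaContH γ₀ β →
      (∀ γ : ℝ, 0 < γ → γ ≤ γ₀ → ∀ (n : ℕ) (gs gs' : ℕ → ℝ), RGEqH n β gs → RGEqH n β gs' →
        Step.InInterval γ n gs → Step.InInterval γ n gs' → gs 0 < gs' 0 → ∀ k, k ≤ n → gs k < gs' k) →
      (EndpointExistence (modelOf β) ↔
        ∃ γ₂ : ℝ, 0 < γ₂ ∧ ∀ γ : ℝ, 0 < γ → γ ≤ γ₂ → ∃ gstar : ℝ, 0 < gstar ∧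
          ∀ (n : ℕ) (gs : ℕ → ℝ), RGEqH n β gs → Step.InInterval γ n gs → ∀ k, k ≤ n → gs k = γ → gstar ≤ gs n) := by
  intro h
  exact not_endpointExistence_betaU ((h betaU 1 one_pos (betaContH_betaU 1) hord_betaU).mpr topRunCriterion_betaU)

/-- **(D)'s END criterion is FALSE with the side condition `0 < γ₀` deleted**: at `γ₀ = 0` the boxes are empty and (C) ∕ (U) ∕ order are
vacuous. [folklore] -/
theorem endTopRunCriterion_false_without_hpos :
    ¬ ∀ (β : HBeta) (γ₀ β' : ℝ), 0 ≤ β' → BetaContH γ₀ β → BetaUpperH β' γ₀ β →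
      (∀ γ : ℝ, 0 < γ → γ ≤ γ₀ → ∀ (n : ℕ) (gs gs' : ℕ → ℝ), RGEqH n β gs → RGEqH n β gs' →
        Step.InInterval γ n gs → Step.InInterval γ n gs' → gs 0 < gs' 0 → ∀ k, k ≤ n → gs k < gs' k) →
      (EndpointExistence (modelOf β) ↔
        ∃ γ₂ : ℝ, 0 < γ₂ ∧ ∀ γ : ℝ, 0 < γ → γ ≤ γ₂ → ∃ gstar : ℝ, 0 < gstar ∧
          ∀ (n : ℕ) (gs : ℕ → ℝ), RGEqH n β gs → Step.InInterval γ n gs → ∀ k, k ≤ n → gs k = γ → gstar ≤ gs n) := by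
  intro h
  have hU : BetaUpperH 0 0 betaU := by
    intro k v hv
    have := (mem_box.mp hv) (Fin.last k)
    linarith [this.1, this.2]
  have hO : ∀ γ : ℝ, 0 < γ → γ ≤ 0 → ∀ (n : ℕ) (gs gs' : ℕ → ℝ), RGEqH n betaU gs → RGEqH n betaU gs' →
      Step.InInterval γ n gs → Step.InInterval γ n gs' → gs 0 < gs' 0 → ∀ k, k ≤ n → gs k < gs' k := by
    intro γ hγ hγ0
    linarith
  exact not_endpointExistence_betaU ((h betaU 0 0 le_rfl (betaContH_betaU 0) hU hO).mpr topRunCriterion_betaU)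

/-- **(D)'s side condition `0 ≤ β′` is REDUNDANT**: the criterion holds for every `β′` (replace it by `max β′ 0`). [folklore] -/
theorem endpointExistence_modelOf_iff_topRuns_noSign {β : HBeta} {γ₀ β' : ℝ} (hγ₀ : 0 < γ₀) (hcont : BetaContH γ₀ β)
    (hhi : BetaUpperH β' γ₀ β)
    (hord : ∀ γ : ℝ, 0 < γ → γ ≤ γ₀ → ∀ (n : ℕ) (gs gs' : ℕ → ℝ), RGEqH n β gs → RGEqH n β gs' →
      Step.InInterval γ n gs → Step.InInterval γ n gs' → gs 0 < gs' 0 → ∀ k, k ≤ n → gs k < gs' k) :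
    EndpointExistence (modelOf β) ↔
      ∃ γ₂ : ℝ, 0 < γ₂ ∧ ∀ γ : ℝ, 0 < γ → γ ≤ γ₂ → ∃ gstar : ℝ, 0 < gstar ∧
        ∀ (n : ℕ) (gs : ℕ → ℝ), RGEqH n β gs → Step.InInterval γ n gs → ∀ k, k ≤ n → gs k = γ → gstar ≤ gs n :=
  endpointExistence_modelOf_iff_topRuns hγ₀ (le_max_right β' 0) hcont (fun k v hv => (hhi k v hv).trans (le_max_left β' 0)) hord

/-- (U) FAILS for the blow-up family at every level `γ₀ ≤ 1` and every `β′` — DERIVED from (D)'s criterion (all other binders hold, the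
top runs hold, the END fails). [folklore] -/
theorem not_betaUpperH_betaU {γ₀ : ℝ} (hγ₀ : 0 < γ₀) (hγ₁ : γ₀ ≤ 1) (β' : ℝ) : ¬ BetaUpperH β' γ₀ betaU := by
  intro hhi
  have hord' : ∀ γ : ℝ, 0 < γ → γ ≤ γ₀ → ∀ (n : ℕ) (gs gs' : ℕ → ℝ), RGEqH n betaU gs → RGEqH n betaU gs' →
      Step.InInterval γ n gs → Step.InInterval γ n gs' → gs 0 < gs' 0 → ∀ k, k ≤ n → gs k < gs' k :=
    fun γ hγ hγ' => hord_betaU γ hγ (hγ'.trans hγ₁)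
  have hiff := endpointExistence_modelOf_iff_topRuns_noSign hγ₀ (betaContH_betaU γ₀) hhi hord'
  exact not_endpointExistence_betaU
    (hiff.mpr ⟨γ₀, hγ₀, fun γ hγ hγ' => ⟨γ, hγ, fun n gs hrg hI => topRuns_betaU (hγ'.trans hγ₁) n gs hrg hI⟩⟩)

/-- **R-35 — the witness of record for the letter (U)**: a Markov family with sign, (C) on every box, (D)'s `hord` and the top-run condition
at every level `≤ 1`, NO END, and (U) at no level `≤ 1` with any constant.  With `EndContLetterWitness.contLetter_loadBearing_on_orderRoads` ((C)),
`endTopRunCriterion_false_without_hpos` (`0 < γ₀`), `endpointExistence_modelOf_iff_topRuns_noSign` (`0 ≤ β′` redundant) and the order letter's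
witness (`Gaps/EndTopRunCrossingWitness`; g1-plan-2's MODEL kernel §15) this is the BINDER CENSUS of (D)'s criterion: four load-bearing, one
redundant. [folklore] -/
theorem upperLetter_loadBearing_on_orderRoads :
    ∃ β : HBeta, BetaLowerH 0 1 β ∧ (∀ γ : ℝ, BetaContH γ β) ∧
      (∀ γ : ℝ, 0 < γ → γ ≤ 1 → ∀ (n : ℕ) (gs gs' : ℕ → ℝ), RGEqH n β gs → RGEqH n β gs' →
        Step.InInterval γ n gs → Step.InInterval γ n gs' → gs 0 < gs' 0 → ∀ k, k ≤ n → gs k < gs' k) ∧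
      (∀ γ : ℝ, γ ≤ 1 → ∀ (n : ℕ) (gs : ℕ → ℝ), RGEqH n β gs → Step.InInterval γ n gs → ∀ k, k ≤ n → gs k = γ → γ ≤ gs n) ∧
      ¬ EndpointExistence (modelOf β) ∧ (∀ γ₀ β' : ℝ, 0 < γ₀ → γ₀ ≤ 1 → ¬ BetaUpperH β' γ₀ β) :=
  ⟨betaU, betaLowerH_betaU, betaContH_betaU, hord_betaU, fun _ hγ n gs hrg hI => topRuns_betaU hγ n gs hrg hI,
    not_endpointExistence_betaU, fun _ β' hγ₀ hγ₁ => not_betaUpperH_betaU hγ₀ hγ₁ β'⟩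

/-- **THE BINDER CENSUS in one line (the three deletions certified in this leaf and `EndContLetterWitness`)**: (C), (U) and `0 < γ₀` are each
load-bearing for (D)'s END criterion; the order letter's witness is `Gaps/EndTopRunCrossingWitness` (and g1-plan-2's MODEL kernel §15, HOME);
`0 ≤ β′` is redundant (`…_noSign`). [folklore] -/
theorem endTopRunCriterion_binderCensus :
    (¬ ∀ (β : HBeta) (γ₀ β' : ℝ), 0 < γ₀ → 0 ≤ β' → BetaUpperH β' γ₀ β →
      (∀ γ : ℝ, 0 < γ → γ ≤ γ₀ → ∀ (n : ℕ) (gs gs' : ℕ → ℝ), RGEqH n β gs → RGEqH n β gs' →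
        Step.InInterval γ n gs → Step.InInterval γ n gs' → gs 0 < gs' 0 → ∀ k, k ≤ n → gs k < gs' k) →
      (EndpointExistence (modelOf β) ↔
        ∃ γ₂ : ℝ, 0 < γ₂ ∧ ∀ γ : ℝ, 0 < γ → γ ≤ γ₂ → ∃ gstar : ℝ, 0 < gstar ∧
          ∀ (n : ℕ) (gs : ℕ → ℝ), RGEqH n β gs → Step.InInterval γ n gs → ∀ k, k ≤ n → gs k = γ → gstar ≤ gs n)) ∧
    (¬ ∀ (β : HBeta) (γ₀ : ℝ), 0 < γ₀ → BetaContH γ₀ β →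
      (∀ γ : ℝ, 0 < γ → γ ≤ γ₀ → ∀ (n : ℕ) (gs gs' : ℕ → ℝ), RGEqH n β gs → RGEqH n β gs' →
        Step.InInterval γ n gs → Step.InInterval γ n gs' → gs 0 < gs' 0 → ∀ k, k ≤ n → gs k < gs' k) →
      (EndpointExistence (modelOf β) ↔
        ∃ γ₂ : ℝ, 0 < γ₂ ∧ ∀ γ : ℝ, 0 < γ → γ ≤ γ₂ → ∃ gstar : ℝ, 0 < gstar ∧
          ∀ (n : ℕ) (gs : ℕ → ℝ), RGEqH n β gs → Step.InInterval γ n gs → ∀ k, k ≤ n → gs k = γ → gstar ≤ gs n)) ∧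
    (¬ ∀ (β : HBeta) (γ₀ β' : ℝ), 0 ≤ β' → BetaContH γ₀ β → BetaUpperH β' γ₀ β →
      (∀ γ : ℝ, 0 < γ → γ ≤ γ₀ → ∀ (n : ℕ) (gs gs' : ℕ → ℝ), RGEqH n β gs → RGEqH n β gs' →
        Step.InInterval γ n gs → Step.InInterval γ n gs' → gs 0 < gs' 0 → ∀ k, k ≤ n → gs k < gs' k) →
      (EndpointExistence (modelOf β) ↔
        ∃ γ₂ : ℝ, 0 < γ₂ ∧ ∀ γ : ℝ, 0 < γ → γ ≤ γ₂ → ∃ gstar : ℝ, 0 < gstar ∧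
          ∀ (n : ℕ) (gs : ℕ → ℝ), RGEqH n β gs → Step.InInterval γ n gs → ∀ k, k ≤ n → gs k = γ → gstar ≤ gs n)) :=
  ⟨endTopRunCriterion_false_without_hcont, endTopRunCriterion_false_without_hhi, endTopRunCriterion_false_without_hpos⟩

/-! ## §3 The (U) column: a PER-LEVEL bound is load-bearing, uniformity in `k` is spare (witness parts of kernel §11 ∕ §12, ported) -/

/-- CONSISTENCY WITH `Gaps/EndUpperPerLevel`: the blow-up family violates even the PER-LEVEL bound at every level `≤ 1` — DERIVED from the
per-level criterion `endpointExistence_modelOf_iff_topRuns_locUpper` (it has (C), order and the top runs but not the END). [folklore] -/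
theorem not_perLevelUpper_betaU {γ₀ : ℝ} (hγ₀ : 0 < γ₀) (hγ₁ : γ₀ ≤ 1) :
    ¬ ∀ k : ℕ, ∃ B : ℝ, ∀ v : Fin (k + 1) → ℝ, v ∈ Box γ₀ k → betaU k v ≤ B := by
  intro hloc
  have hord' : ∀ γ : ℝ, 0 < γ → γ ≤ γ₀ → ∀ (n : ℕ) (gs gs' : ℕ → ℝ), RGEqH n betaU gs → RGEqH n betaU gs' →
      Step.InInterval γ n gs → Step.InInterval γ n gs' → gs 0 < gs' 0 → ∀ k, k ≤ n → gs k < gs' k :=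
    fun γ hγ hγ' => hord_betaU γ hγ (hγ'.trans hγ₁)
  have hiff := endpointExistence_modelOf_iff_topRuns_locUpper hγ₀ (betaContH_betaU γ₀) hloc hord'
  exact not_endpointExistence_betaU
    (hiff.mpr ⟨γ₀, hγ₀, fun γ hγ hγ' => ⟨γ, hγ, fun n gs hrg hI => topRuns_betaU (hγ'.trans hγ₁) n gs hrg hI⟩⟩)

/-- **R-36 (census refinement of R-35, reformulation of record, zero weight).**  On the END road the upper-bound letter is consumed PER LEVEL:
(i) (D)'s criterion holds with per-level bounds in place of the uniform (U); (ii) a per-level bound IS load-bearing (the blow-up family of N-16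
violates it and the criterion's conclusion); (iii) under (G)'s letters no upper-bound binder is needed at all. [folklore] -/
theorem upperLetter_perLevel_census :
    (∀ (β : HBeta) (γ₀ : ℝ), 0 < γ₀ → BetaContH γ₀ β → (∀ k : ℕ, ∃ B : ℝ, ∀ v : Fin (k + 1) → ℝ, v ∈ Box γ₀ k → β k v ≤ B) →
      (∀ γ : ℝ, 0 < γ → γ ≤ γ₀ → ∀ (n : ℕ) (gs gs' : ℕ → ℝ), RGEqH n β gs → RGEqH n β gs' →
        Step.InInterval γ n gs → Step.InInterval γ n gs' → gs 0 < gs' 0 → ∀ k, k ≤ n → gs k < gs' k) →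
      (EndpointExistence (modelOf β) ↔
        ∃ γ₂ : ℝ, 0 < γ₂ ∧ ∀ γ : ℝ, 0 < γ → γ ≤ γ₂ → ∃ gstar : ℝ, 0 < gstar ∧
          ∀ (n : ℕ) (gs : ℕ → ℝ), RGEqH n β gs → Step.InInterval γ n gs → ∀ k, k ≤ n → gs k = γ → gstar ≤ gs n)) ∧
    (∃ β : HBeta, (∀ γ : ℝ, BetaContH γ β) ∧ ¬ EndpointExistence (modelOf β) ∧
      ∀ γ₀ : ℝ, 0 < γ₀ → γ₀ ≤ 1 → ¬ ∀ k : ℕ, ∃ B : ℝ, ∀ v : Fin (k + 1) → ℝ, v ∈ Box γ₀ k → β k v ≤ B) :=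
  ⟨fun _ _ hγ₀ hcont hloc hord => endpointExistence_modelOf_iff_topRuns_locUpper hγ₀ hcont hloc hord,
    ⟨betaU, betaContH_betaU, not_endpointExistence_betaU, fun _ hγ₀ hγ₁ => not_perLevelUpper_betaU hγ₀ hγ₁⟩⟩

/-- The (U) census over the END sockets of the tree that take (U) as an input, collected (zero weight): at the W-β socket (hence the sign
socket, `M = 0`, and every road funnelled through `FlowStepRuns.endpointExistence_of_partialSums`) and at the order socket per-level bounds
suffice (`Gaps/EndUpperPerLevel`); the blow-up family shows a per-level bound cannot be dropped at the order socket. [folklore] -/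
theorem upperLetter_perLevel_census_roads :
    (∀ (β : HBeta) (γ₀ M : ℝ), 0 < γ₀ → 0 ≤ M → BetaContH γ₀ β → BetaPartialSumsLowerH M γ₀ β →
        (∀ k : ℕ, ∃ B : ℝ, ∀ v : Fin (k + 1) → ℝ, v ∈ Box γ₀ k → β k v ≤ B) → EndpointExistence (modelOf β)) ∧
    (∀ (β : HBeta) (γ₀ : ℝ), 0 < γ₀ → BetaContH γ₀ β →
        (∀ k : ℕ, ∃ B : ℝ, ∀ v : Fin (k + 1) → ℝ, v ∈ Box γ₀ k → β k v ≤ B) →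
        (∀ γ : ℝ, 0 < γ → γ ≤ γ₀ → ∀ (n : ℕ) (gs gs' : ℕ → ℝ), RGEqH n β gs → RGEqH n β gs' →
          Step.InInterval γ n gs → Step.InInterval γ n gs' → gs 0 < gs' 0 → ∀ k, k ≤ n → gs k < gs' k) →
        (EndpointExistence (modelOf β) ↔
          ∃ γ₂ : ℝ, 0 < γ₂ ∧ ∀ γ : ℝ, 0 < γ → γ ≤ γ₂ → ∃ gstar : ℝ, 0 < gstar ∧
            ∀ (n : ℕ) (gs : ℕ → ℝ), RGEqH n β gs → Step.InInterval γ n gs → ∀ k, k ≤ n → gs k = γ → gstar ≤ gs n)) ∧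
    (∃ β : HBeta, (∀ γ : ℝ, BetaContH γ β) ∧ ¬ EndpointExistence (modelOf β) ∧
        ∀ γ₀ : ℝ, 0 < γ₀ → γ₀ ≤ 1 → ¬ ∀ k : ℕ, ∃ B : ℝ, ∀ v : Fin (k + 1) → ℝ, v ∈ Box γ₀ k → betaU k v ≤ B) :=
  ⟨fun _ _ _ hγ₀ hM hcont hps hloc => endpointExistence_modelOf_of_partialSums_locUpper hγ₀ hM hcont hps hloc,
   fun _ _ hγ₀ hcont hloc hord => endpointExistence_modelOf_iff_topRuns_locUpper hγ₀ hcont hloc hord,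
   ⟨betaU, betaContH_betaU, not_endpointExistence_betaU, fun _ hγ₀ hγ₁ => not_perLevelUpper_betaU hγ₀ hγ₁⟩⟩

/-! ## §4 The (C) column: trace continuity ALONG THE CLAMPED FOLIATION is load-bearing, continuity off it is spare (witness part of kernel §13,
ported; `Gaps/EndContLetterWitness` + `Gaps/EndContAlongFoliation` + `Gaps/EndFoliationHeadline` §1 as black boxes) -/

/-- CONSISTENCY WITH `Gaps/EndContAlongFoliation`, DERIVED from its criterion: the floor-staircase family `betaJ` — every order letter, (U),
top-runs at every level, NO `EndpointExistence` — is discontinuous ALONG THE FOLIATION at every level `γ₀ > 0` (directly: its `k = 0` trace is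
`x ↦ stair x`).  (C) along the foliation is LOAD-BEARING on the order roads; what is spare is continuity OFF the foliation. [folklore] -/
theorem not_folCont_betaJ {γ₀ : ℝ} (hγ₀ : 0 < γ₀) :
    ¬ ∀ k : ℕ, ContinuousOn (fun x : ℝ => betaJ k (clampPrefix betaJ γ₀ k x)) (Set.Ioc 0 γ₀) := fun hfol =>
  not_endpointExistence_betaJ ((endpointExistence_modelOf_iff_topRuns_folCont hγ₀ zero_le_one hfol
    (folUpper_of_betaUpperH hγ₀ (betaUpperH_betaJ γ₀)) hord_betaJ).mpr topRunCriterion_betaJ)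

/-- **R-37 (census refinement of R-35 ∕ R-36, reformulation of record, zero weight) — THE (C) COLUMN.**  On the END roads every box letter is
consumed through its TRACE ON THE γ₀-CLAMPED FORWARD FOLIATION: (i) (D)'s criterion holds with continuity and (per-level) upper bounds of
the traces `x ↦ β_k(clampPrefix β γ₀ k x)` in place of (C) and (U) on the boxes; (ii) the W-β road holds with (C), (U), (PS) all along the
foliation; (iii) the trace condition IS continuity of the clamped table `Y_k`; (iv) continuity of the traces is load-bearing (N-15's witness
violates it at every level and has no END); the box letters imply the foliation letters. [folklore] -/
theorem contLetter_foliation_census :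
    (∀ (β : HBeta) (γ₀ : ℝ), 0 < γ₀ →
        (∀ k : ℕ, ContinuousOn (fun x : ℝ => β k (clampPrefix β γ₀ k x)) (Set.Ioc 0 γ₀)) →
        (∀ k : ℕ, ∃ B : ℝ, ∀ x : ℝ, 0 < x → x ≤ γ₀ → β k (clampPrefix β γ₀ k x) ≤ B) →
        (∀ γ : ℝ, 0 < γ → γ ≤ γ₀ → ∀ (n : ℕ) (gs gs' : ℕ → ℝ), RGEqH n β gs → RGEqH n β gs' →
          Step.InInterval γ n gs → Step.InInterval γ n gs' → gs 0 < gs' 0 → ∀ k, k ≤ n → gs k < gs' k) →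
        (EndpointExistence (modelOf β) ↔
          ∃ γ₂ : ℝ, 0 < γ₂ ∧ ∀ γ : ℝ, 0 < γ → γ ≤ γ₂ → ∃ gstar : ℝ, 0 < gstar ∧
            ∀ (n : ℕ) (gs : ℕ → ℝ), RGEqH n β gs → Step.InInterval γ n gs → ∀ k, k ≤ n → gs k = γ → gstar ≤ gs n)) ∧
    (∀ (β : HBeta) (γ₀ M : ℝ), 0 < γ₀ → 0 ≤ M →
        (∀ k : ℕ, ContinuousOn (fun x : ℝ => β k (clampPrefix β γ₀ k x)) (Set.Ioc 0 γ₀)) →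
        (∀ k : ℕ, ∃ B : ℝ, ∀ x : ℝ, 0 < x → x ≤ γ₀ → β k (clampPrefix β γ₀ k x) ≤ B) →
        (∀ x : ℝ, 0 < x → x ≤ γ₀ → ∀ k n : ℕ, k ≤ n → -M ≤ ∑ j ∈ Finset.Ico k n, β j (clampPrefix β γ₀ j x)) →
        EndpointExistence (modelOf β)) ∧
    (∀ (β : HBeta) (γ₀ : ℝ), (∀ k : ℕ, ContinuousOn (fun x : ℝ => β k (clampPrefix β γ₀ k x)) (Set.Ioc 0 γ₀)) ↔
        ∀ k : ℕ, ContinuousOn (Y β γ₀ k) (Set.Ioc 0 γ₀)) ∧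
    (∃ β : HBeta, ¬ EndpointExistence (modelOf β) ∧
        (∀ γ₀ : ℝ, ∀ γ : ℝ, 0 < γ → γ ≤ γ₀ → ∀ (n : ℕ) (gs gs' : ℕ → ℝ), RGEqH n β gs → RGEqH n β gs' →
          Step.InInterval γ n gs → Step.InInterval γ n gs' → gs 0 < gs' 0 → ∀ k, k ≤ n → gs k < gs' k) ∧
        ∀ γ₀ : ℝ, 0 < γ₀ → ¬ ∀ k : ℕ, ContinuousOn (fun x : ℝ => β k (clampPrefix β γ₀ k x)) (Set.Ioc 0 γ₀)) ∧
    (∀ (β : HBeta) (γ₀ : ℝ), 0 < γ₀ → BetaContH γ₀ β →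
        ∀ k : ℕ, ContinuousOn (fun x : ℝ => β k (clampPrefix β γ₀ k x)) (Set.Ioc 0 γ₀)) :=
  ⟨fun _ _ hγ₀ hfol hloc hord => endpointExistence_iff_topRuns_foliation_locUpper (modelOf_forwardGenerated _) (modelOf_haltsOutside _)
      (modelOf_curries _) hγ₀ hfol hloc hord,
   fun _ _ _ hγ₀ hM hfol hloc hps => endpointExistence_of_foliationLetters_locUpper (modelOf_forwardGenerated _) hγ₀ hM hfol hloc hps,
   fun _ _ => folCont_iff_continuousOn_Y,
   ⟨betaJ, not_endpointExistence_betaJ, fun _ => hord_betaJ, fun _ hγ₀ => not_folCont_betaJ hγ₀⟩,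
   fun _ _ hγ₀ hcont => folCont_of_betaContH hγ₀ hcont⟩

end

end Summit.QuantumFields.BalabanUV.Gaps.EndUpperLetterWitness
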